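import Literature.Computability.Complexity.RandomizedModularZeroTestHeight
import Literature.Computability.AlgebraicComplexity.CircuitCodeModularEvaluator
import HarnessLib

/-!
# The zero set of the junk-tolerant circuit-code semantics is in `coRP`

Topic `Computability/AlgebraicComplexity`. `CircuitCode.semPoly w` (`CircuitCodeReading.lean`) reads
EVERY string `w` as a division-free integer circuit over `|w|` variables (junk-tolerantly) and takes
its polynomial; this file records

* `CircuitCode.semPolyZero_mem_coRP : {w | semPoly w = 0} ∈ coRP` — the randomised modular zero test
  (random point of `[0, 2^k)^{|w|}`, random `K`-bit modulus; Schwartz 1980 §3 / Ibarra–Moran 1983 §4,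
  in the tree `ModularZeroTest.mem_coRP_of_modularZeroTest_height`) fed with the degree bound
  `totalDegree_semPoly_le` (`≤ 2^{n²}`), the height bound `natAbs_eval_semPoly_le`
  (`≤ 2^{2^{n²+3n}(B+1)}`) and the `FP` evaluator `CircuitCode.evalF`
  (`CircuitCodeModularEvaluator.lean`: `evalF_mem_FP`, `evalF_oneBit`, `evalF_spec`) at the parameter
  polynomials `K = 4h + 4d + 26`, `k = h + 2d + 8` (`d = X²`, `h = X² + 3X`).

It is the one-sided form of `Literature.Barriers.ValiantsHypothesis.semPolyZero_mem_BPP`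
(`BIJL18Thm5Holds.lean`) and the hypothesis `hB` of `PITLanguage_mem_coRP_of_semPolyZero`
(`PITLanguageCompression.lean`): with the two writer machines of that file it yields `ACIT ∈ coRP`
for the full language `PITLanguage`. Theorem-only; no named fact. Honest framing: textbook material
(randomised identity testing); nothing here bears on `VP ≠ VNP`, which is NOT proved.

## References

* [Schwartz1980] J. T. Schwartz, J. ACM 27 (1980) 701–717, Cor. 1 and §3.
* [IbarraMoran1983] O. H. Ibarra, S. Moran, J. ACM 30 (1983) 217–228, §4.
* [KabanetsImpagliazzo2004] V. Kabanets, R. Impagliazzo, Comput. Complexity 13 (2004) 1–46, Lemma 2.2.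
* [AroraBarakCC2009] S. Arora, B. Barak, CUP 2009, Lemma 7.5, §7.2.3.
-/

noncomputable section

namespace Literature.Computability.AlgebraicComplexity.CircuitCode

open Literature.Computability.Complexity Literature.Computability.Complexity.ModularZeroTest
open _root_.Computability Polynomial

/-- **`{w | semPoly w = 0} ∈ coRP`**: the randomised modular zero test on the junk-tolerant circuit-code
semantics never rejects a string whose circuit computes the zero polynomial, and rejects every other
string with probability `≥ 1/2` (point blocks of `k(n) = h + 2d + 8` bits, modulus of
`K(n) = 4h + 4d + 26` bits, `d = n²`, `h = n² + 3n`, `n = |w|`).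
[cite: Schwartz1980, Cor. 1 and §3] [cite: IbarraMoran1983, §4] [cite: KabanetsImpagliazzo2004, Lemma 2.2] -/
theorem semPolyZero_mem_coRP : ({w | semPoly w = 0} : Language Bool) ∈ coRP := by
  have hK : ∀ n : ℕ, (Polynomial.C 4 * (X ^ 2 + Polynomial.C 3 * X) + Polynomial.C 4 * X ^ 2 +
      Polynomial.C 26 : Polynomial ℕ).eval n = KOfH (X ^ 2) (X ^ 2 + Polynomial.C 3 * X) n := by
    intro n; simp [KOfH]
  have hk : ∀ n : ℕ, (X ^ 2 + Polynomial.C 3 * X + Polynomial.C 2 * X ^ 2 + Polynomial.C 8 :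
      Polynomial ℕ).eval n = kOfH (X ^ 2) (X ^ 2 + Polynomial.C 3 * X) n := by
    intro n; simp [kOfH]
  refine mem_coRP_of_modularZeroTest_height (v := X) (d := X ^ 2) (h := X ^ 2 + Polynomial.C 3 * X)
    semPoly (fun w => totalDegree_semPoly_le w) (fun w B a ha => natAbs_eval_semPoly_le w a ha)
    (evalF_mem_FP (Polynomial.C 4 * (X ^ 2 + Polynomial.C 3 * X) + Polynomial.C 4 * X ^ 2 +
      Polynomial.C 26) (X ^ 2 + Polynomial.C 3 * X + Polynomial.C 2 * X ^ 2 + Polynomial.C 8))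
    (evalF_oneBit _ _) (fun w y hy => ?_)
  rw [eval_coinPolyH, eval_X, ← hK, ← hk] at hy
  have h := evalF_spec _ _ w y hy
  rw [hK, hk] at h
  exact h

end Literature.Computability.AlgebraicComplexity.CircuitCode
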